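import Literature.AlgebraicGeometry.HodgeTheory.RealMultiplicationPowersHodgeClasses
import HarnessLib

/-!
# Hodge classes on abelian varieties with slots over `A`, when `End_Hdg(H¹(A)) ⊗ ℂ` is diagonalised by REAL characters with two-dimensional blocks, are generated by divisor classes — the Lie step and the assembly with `End⁰(A)` NOT assumed to be a field (Hazama 1983 §3; Ribet 1983 Thm. 0–1)

Family `hodge`, layer `Literature/AlgebraicGeometry/HodgeTheory`. Research context: cell `pub-hodge-ring2`
(HONEST FRAMING: research route conditional on HC_CM; not a corollary; Q11.4-sentence-2 already refuted in
dim ≥ 3), Literature lane, programme R3 (two orthogonal real-multiplication factors; `pub-hodge-ring2-lit-g40/PLAN-R3.md`,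
bricks for R3-BD). This file is the tree's `RealMultiplicationPowersHodgeClasses` §2–§3 (`AVSlots.exists_rmInvariant_coeff`,
`AVSlots.rmHodgeClasses_divisorial`) with the hypothesis «`End⁰(A)` is a totally real FIELD of degree `dim A`»
replaced by its abstract consequences used in the proof: a family of REAL characters `σ_τ` of `End_Hdg(H¹(A))`
whose eigenblocks `V_τ` form an internal direct sum of `H¹(A) ⊗ ℂ` with `dim V_τ = 2`, the `ψ`-self-adjointness
of `End_Hdg` (automatic, `Motives/HodgeEndomorphismsSelfAdjointOfRealCharacters`, but kept as a hypothesis to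
keep the import cone inside the old tree), and — for the assembly — Hodge-adapted block bases `b_τ` whose classes
`ρ(b_τ 0) ⌣ ρ(b_τ 1)` are combinations of rational `(1,1)`-classes. It applies verbatim to `A = A₁ × A₂` with
`End_Hdg = E₁ × E₂` (`HOneOfProductEndomorphismBlocks`, `RealMultiplicationProductHodgeLieAlgebra`). UNCONDITIONAL;
no definition, no named fact; no step towards a summit statement.

## Statements

* **`AvSlots.exists_invariant_coeff_of_real_characters`** (the INVARIANCE THEOREM, Lie step): for `B` with slots
  `g` over `A`, every rational `(p,p)`-class on `B` (`p ≥ 1`) is `∑_w a(w) (g b)_w` for a coefficient function `a`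
  on slot-and-place words killed, slice by slice, by every trace-free `N ∈ M₂(ℂ)` placed at the positions of any
  one place `τ` («the i-th component acts on `V_i ⊕ ⋯ ⊕ V_i` diagonally», Hazama p. 306) — proof = the tree's
  `exists_rmInvariant_coeff` with `(EndField A hF →+* ℂ, hodgeCharacter)` replaced by `(T, σ)`;
* **`AVSlots.hodgeClasses_divisorial_of_blockBasis`** (assembly): if moreover `ρ(b_τ 0) ⌣ ρ(b_τ 1)` lies in the
  span of the rational `(1,1)`-classes of `A` for every `τ`, then `Bᵖ(B) ⊆ Dᵖ(B) ⊗ ℂ` (the colourwise first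
  fundamental theorem `wordEval_rmLetters_mem_divisorClassesSpan_of_colourwise`); `AVSlots.isDivisorGenerated_of_blockBasis`.

## References

* [Ribet1983] K. A. Ribet, Amer. J. Math. 105 (1983), Thm. 0 and Thm. 1. [cite: Ribet1983, Thm. 0–1]
* [Hazama1983] F. Hazama, Tôhoku Math. J. 35 (1983), Thm. (1.1), §3 pp. 305–306.
  [cite: Hazama1983, Thm. (1.1) and §3 (pp. 305–306)]
* [MoonenZarhin1999LowDim] B. Moonen, Yu. Zarhin, Duke Math. J. 98 (1999), §3 Thm. (3.2)(1).
  [cite: MoonenZarhin1999LowDim, §3 Thm. (3.2)(1)]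
* [GoodmanWallachGTM255] R. Goodman, N. R. Wallach, GTM 255 (2009), §4.1.1. [cite: GoodmanWallachGTM255, §4.1.1]
-/

noncomputable section

open scoped TensorProduct
open CategoryTheory Module NumberField

namespace Literature.AlgebraicGeometry.HodgeTheory

open Literature.AlgebraicTopology.SingularHomology
open Literature.AlgebraicGeometry.Motives (IsSmoothProjective AbelianVariety bettiCohomology
  ofRatClassBaseChange ofRatClassBaseChange_tmul HodgeTensorFacts hodgeTensorFacts_holds)
open Literature.Barriers.HodgeConjecture
open Literature.AlgebraicGeometry.Motives.HodgeStructure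
open Literature.AlgebraicGeometry.ComplexMultiplication
open Literature.RepresentationTheory.GeneralLinear
open Literature.NumberTheory.DiophantineGeometry

section RealCharacters

variable {A B : AbelianVariety ℂ} {n : ℕ} {g : Fin n → (B ⟶ A)}

/-- The two elements of `Fin 2`. [folklore] -/
private theorem fin2_eq_zero_or_one' (r : Fin 2) : r = 0 ∨ r = 1 := by
  fin_cases r <;> simp

open scoped Classical in
/-- **The INVARIANCE THEOREM for a family of real characters (Ribet 1983 Thm. 0 / Hazama 1983 §3, Lie step,
for abelian varieties with slots over `A`).** Let `A` be a complex abelian variety, `ψ` a polarization of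
`H¹(A(ℂ); ℚ)` for which `End_Hdg(H¹)` is self-adjoint, `σ_τ` (`τ ∈ T`) REAL characters of `End_Hdg(H¹(A))` whose
eigenblocks `V_τ` give `H¹(A) ⊗ ℂ = ⊕_τ V_τ` with `dim V_τ = 2`, `b_τ` bases of the `V_τ` adapted to the Hodge
decomposition, and `B` an abelian variety with slots `g` over `A`. Then every rational class `c` of type
`(p,p)` on `B` (`p ≥ 1`) is `∑_w a(w) · (g b)_w` for a coefficient function `a` on words in the letters
`((j, τ), r)` such that for every slot-and-place word `U`, every place `τ` and every trace-free `N ∈ M₂(ℂ)`,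
the operator `N` placed at the positions of place `τ` kills the slice `a(U, −)`. The tree's
`AVSlots.exists_rmInvariant_coeff` is the case `T = (E →+* ℂ)`, `σ = hodgeCharacter` of a totally real field
`E = End⁰(A)` of degree `dim A`; the proof is the same (THEOREM L `HodgeStructure.wordDerAt_eq_zero_of_mapsTo_of_skew`
is already stated for a family of characters). [cite: Ribet1983, Thm. 0–1 (pp. 523–525)]
[cite: Hazama1983, Thm. (1.1) and §3 (pp. 305–306)] [cite: MoonenZarhin1999LowDim, §3 Thm. (3.2)(1)] -/
theorem AVSlots.exists_invariant_coeff_of_real_characters [HodgeTensorFacts.{0, 0}] (hg : AVSlots A B g)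
    (hHD : exists_isReal_hodgeModel) (hI : hodgePQ_independent_of_hodgeModel)
    {T : Type} [Fintype T] [DecidableEq T]
    (ψ : (BettiUniverse.hodge hHD (AbelianVariety.isSmoothProjective_holds (A := A)) 1).Polarization)
    (hself : ∀ a : (BettiUniverse.hodge hHD (AbelianVariety.isSmoothProjective_holds (A := A)) 1).endAlg,
      LinearMap.IsAdjointPair ψ.form ψ.form (a : Module.End ℚ (bettiCohomology A.X 1))
        (a : Module.End ℚ (bettiCohomology A.X 1)))
    (σ : T → ((BettiUniverse.hodge hHD (AbelianVariety.isSmoothProjective_holds (A := A)) 1).endAlg →+* ℂ))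
    (hreal : ∀ τ, (starRingEnd ℂ).comp (σ τ) = σ τ)
    (hint : DirectSum.IsInternal fun τ =>
      (BettiUniverse.hodge hHD (AbelianVariety.isSmoothProjective_holds (A := A)) 1).eigenBlock (σ τ))
    (h2 : ∀ τ, Module.finrank ℂ
      ((BettiUniverse.hodge hHD (AbelianVariety.isSmoothProjective_holds (A := A)) 1).eigenBlock (σ τ)) = 2)
    (b : ∀ τ, Module.Basis (Fin 2) ℂ
      ((BettiUniverse.hodge hHD (AbelianVariety.isSmoothProjective_holds (A := A)) 1).eigenBlock (σ τ)))
    (hb0 : ∀ τ, (b τ 0 : ℂ ⊗[ℚ] bettiCohomology A.X 1) ∈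
      (BettiUniverse.hodge hHD (AbelianVariety.isSmoothProjective_holds (A := A)) 1).piece 1 0)
    (hb1 : ∀ τ, (b τ 1 : ℂ ⊗[ℚ] bettiCohomology A.X 1) ∈
      (BettiUniverse.hodge hHD (AbelianVariety.isSmoothProjective_holds (A := A)) 1).piece 0 1)
    {p : ℕ} (hp : 0 < p) {c : complexBetti B.X (2 * p)} (hcQ : IsRationalClass c)
    (hc : IsOfHodgeType B.dim B.X (2 * p) p p c) :
    ∃ a : (Fin (2 * p) → (Fin n × T) × Fin 2) → ℂ,
      wordEval (cupPowOneAlt ℂ (Motives.ComplexPoints B.X) (2 * p)) (rmLetters g b) a = c ∧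
      ∀ (U : Fin (2 * p) → Fin n × T) (τ : T) (N : Matrix (Fin 2) (Fin 2) ℂ), N.trace = 0 →
        wordDerAt ℂ (colourOp ℂ (fun t => (U t).2) τ N) (wordSlice a U) = 0 := by
  classical
  -- the setting
  have hX : IsSmoothProjective A.dim A.X := AbelianVariety.isSmoothProjective_holds
  haveI : Module.Finite ℚ (bettiCohomology A.X 1) := finite_bettiCohomology_one A
  have hodd : Odd (((1 : ℕ) : ℤ)) := ⟨0, by norm_num⟩
  set F := cupPowOneAlt ℂ (Motives.ComplexPoints B.X) (2 * p) with hFdef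
  have hFinj : Function.Injective (exteriorPower.alternatingMapLinearEquiv F) :=
    injective_alternatingMapLinearEquiv_cupPowOneAlt B (2 * p)
  -- bases: the block basis `cbσ` and the rational basis `eC`, both indexed by `Fin M`
  set cbx : Module.Basis (T × Fin 2) ℂ (ℂ ⊗[ℚ] bettiCohomology A.X 1) :=
    (hint.collectedBasis b).reindex (Equiv.sigmaEquivProd T (Fin 2)) with hcbx
  set eQ := Module.finBasis ℚ (bettiCohomology A.X 1) with heQ
  set eC : Module.Basis (Fin (Module.finrank ℚ (bettiCohomology A.X 1))) ℂ
    (ℂ ⊗[ℚ] bettiCohomology A.X 1) := Algebra.TensorProduct.basis ℂ eQ with heC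
  set φ : Fin (Module.finrank ℚ (bettiCohomology A.X 1)) ≃ T × Fin 2 := eC.indexEquiv cbx with hφ
  set cbσ : Module.Basis (Fin (Module.finrank ℚ (bettiCohomology A.X 1))) ℂ
    (ℂ ⊗[ℚ] bettiCohomology A.X 1) := cbx.reindex φ.symm with hcbσdef
  have hcbx : ∀ τr : T × Fin 2, (cbx τr : ℂ ⊗[ℚ] bettiCohomology A.X 1) = b τr.1 τr.2 := by
    rintro ⟨τ, r⟩
    simp [cbx, DirectSum.IsInternal.collectedBasis_coe, Equiv.sigmaEquivProd]
  have hcbσ : ∀ m, (cbσ m : ℂ ⊗[ℚ] bettiCohomology A.X 1) = b (φ m).1 (φ m).2 := fun m => by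
    rw [hcbσdef, Module.Basis.reindex_apply, Equiv.symm_symm, hcbx]
  -- letters
  set ρ := ofRatClassBaseChangeEquiv hX 1 with hρ
  set v : Module.Basis _ ℂ (complexBetti A.X 1) := cbσ.map ρ with hv
  set eL : Module.Basis _ ℂ (complexBetti A.X 1) := eC.map ρ with heL
  have heLQ : ∀ i, IsRationalClass (eL i) := fun i => by
    rw [heL, Module.Basis.map_apply, heC, Algebra.TensorProduct.basis_apply, hρ,
      ofRatClassBaseChangeEquiv_apply, ofRatClassBaseChange_tmul, one_smul]
    exact isRationalClass_ofRatClass _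
  set κ : Fin (Module.finrank ℚ (bettiCohomology A.X 1)) → Fin 2 := fun m => (φ m).2 with hκ
  have hv_apply : ∀ m, v m = ofRatClassBaseChange (Motives.ComplexPoints A.X) 1
      (b (φ m).1 (φ m).2 : ℂ ⊗[ℚ] bettiCohomology A.X 1) := fun m => by
    rw [hv, Module.Basis.map_apply, hcbσ, hρ, ofRatClassBaseChangeEquiv_apply]
  have hv0 : ∀ m, κ m = 0 → IsOfHodgeType A.dim A.X 1 1 0 (v m) := by
    intro m hm
    rw [hv_apply, ← BettiUniverse.mem_hodge_piece_iff hHD hI hX (k := 1) (p := 1) (q := 0) rfl]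
    have h := hb0 (φ m).1
    change (φ m).2 = 0 at hm
    rw [← hm] at h
    exact h
  have hv1 : ∀ m, κ m = 1 → IsOfHodgeType A.dim A.X 1 0 1 (v m) := by
    intro m hm
    rw [hv_apply, ← BettiUniverse.mem_hodge_piece_iff hHD hI hX (k := 1) (p := 0) (q := 1) rfl]
    have h := hb1 (φ m).1
    change (φ m).2 = 1 at hm
    rw [← hm] at h
    exact h
  -- (α) an antisymmetric kind-balanced coefficient function in the adapted letters
  obtain ⟨ax, hax_bal, hax_anti, hcax⟩ := hg.exists_antisymm_kindBalanced_wordEval_eq v κ hv0 hv1 hp hc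
  -- the change of letters to the rational letters
  set G : Matrix _ _ ℂ := eC.toMatrix cbσ with hG
  set G' : Matrix _ _ ℂ := cbσ.toMatrix eC with hG'
  have hG'G : G' * G = 1 := cbσ.toMatrix_mul_toMatrix_flip eC
  have hve : ∀ m, v m = ∑ i, G i m • eL i := fun m => by
    simp only [hv, heL, Module.Basis.map_apply, ← map_smul, ← map_sum]
    congr 1
    exact (eC.sum_toMatrix_smul_self (v := ⇑cbσ) (j := m)).symm
  have hletters : ∀ j m, avLetters g v (j, m) = ∑ i, G i m • avLetters g eL (j, i) :=
    avLetters_baseChange g G hve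
  set aE := colourChangeAt (fun _ : Fin n => G) ax with haE
  have haE_anti : IsAntisymm aE := hax_anti.colourChangeAt _
  have hcaE : wordEval F (avLetters g eL) aE = c := by
    rw [haE, ← wordEval_eq_wordEval_colourChangeAt F (fun _ : Fin n => G) hletters ax, hcax]
  -- rationality of `aE`
  obtain ⟨q, hq⟩ := hg.exists_rat_wordEval_eq eL heLQ hcQ
  obtain ⟨q', -, haEq⟩ := haE_anti.exists_eq_algebraMap_of_wordEval_eq hFinj (hg.letterBasis eL)
    (q := q) (by rw [AVSlots.coe_letterBasis, hcaE, hFdef, hq])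
  have hslice_e : ∀ u, wordSlice aE u = wordRepAt ℂ (fun _ : Fin (2 * p) => G) (wordSlice ax u) :=
    fun u => wordSlice_colourChangeAt (fun _ : Fin n => G) ax u
  -- the Hodge operator `Θ`: `diag(±1)` in the adapted letters
  obtain ⟨Θ, hΘ⟩ := exists_hodgeTheta (BettiUniverse.hodge hHD (AbelianVariety.isSmoothProjective_holds (A := A)) 1)
  have hΘb : ∀ m, Θ (cbσ m) = (if κ m = 0 then (1 : ℂ) else -1) • cbσ m := by
    intro m
    rw [hcbσ]
    change Θ _ = (if (φ m).2 = 0 then (1 : ℂ) else -1) • _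
    rcases fin2_eq_zero_or_one' (φ m).2 with h0 | h1
    · rw [h0, if_pos rfl]
      have hmem : (b (φ m).1 0 : ℂ ⊗[ℚ] bettiCohomology A.X 1) ∈ (BettiUniverse.hodge hHD (AbelianVariety.isSmoothProjective_holds (A := A)) 1).piece 1 (((1 : ℕ) : ℤ) - 1) := by
        have e : (((1 : ℕ) : ℤ) - 1) = 0 := by norm_num
        rw [e]; exact hb0 _
      rw [hΘ 1 _ hmem]
      norm_num
    · rw [h1, if_neg one_ne_zero]
      have hmem : (b (φ m).1 1 : ℂ ⊗[ℚ] bettiCohomology A.X 1) ∈ (BettiUniverse.hodge hHD (AbelianVariety.isSmoothProjective_holds (A := A)) 1).piece 0 (((1 : ℕ) : ℤ) - 0) := by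
        have e : (((1 : ℕ) : ℤ) - 0) = 1 := by norm_num
        rw [e]; exact hb1 _
      rw [hΘ 0 _ hmem]
      norm_num
  have hΘcb : LinearMap.toMatrix cbσ cbσ Θ = kindDiag κ := by
    ext i m
    rw [LinearMap.toMatrix_apply, hΘb, map_smul, Module.Basis.repr_self, Finsupp.smul_apply,
      Finsupp.single_apply, kindDiag, Matrix.diagonal_apply, smul_eq_mul, mul_ite, mul_one, mul_zero]
    by_cases him : i = m
    · subst him; rw [if_pos rfl]
    · rw [if_neg (Ne.symm him), if_neg him]
  have hJG : LinearMap.toMatrix eC eC Θ * G = G * kindDiag κ := by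
    rw [← hΘcb, hG, linearMap_toMatrix_mul_basis_toMatrix, basis_toMatrix_mul_linearMap_toMatrix]
  have hΘq : ∀ u : Fin (2 * p) → Fin n, wordDerAt ℂ (fun _ : Fin (2 * p) => LinearMap.toMatrix eC eC Θ)
      (wordSlice (fun w => algebraMap ℚ ℂ (q' w)) u) = 0 := by
    intro u
    rw [← haEq, hslice_e]
    refine wordDerAt_wordRepAt_eq_zero_of_mul_eq ℂ (fun _ : Fin (2 * p) => G) (fun _ => hJG) ?_
    rw [wordDerAt_const]
    exact wordDer_kindDiag_wordSlice_eq_zero κ hax_bal u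
  -- the coefficient function, refined to slot-and-place colours
  refine ⟨placeRefine φ ax, ?_, fun U τ N hN => ?_⟩
  · rw [← hcax]
    have hx : (fun jr : (Fin n × T) × Fin 2 => avLetters g v (jr.1.1, φ.symm (jr.1.2, jr.2))) = rmLetters g b := by
      funext jr
      rw [avLetters_apply, hv_apply, Equiv.apply_symm_apply]
      rfl
    rw [← hx]
    exact wordEval_placeRefine F φ (avLetters g v) ax
  · refine wordDerAt_colourOp_placeRefine_eq_zero φ τ N (fun u => ?_) U
    -- THEOREM L for `Y := 0 ⊕ N ⊕ 0` at place `τ`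
    set Y := RealPlaces.assemble hint b (Pi.single τ N) with hY
    have hYT := RealPlaces.assemble_mapsTo hint b (Pi.single τ N)
    have htr : ∀ τ', ((Pi.single τ N : T → Matrix (Fin 2) (Fin 2) ℂ) τ').trace = 0 := by
      intro τ'
      rw [Pi.single_apply]
      split_ifs
      · exact hN
      · exact Matrix.trace_zero _ _
    have hYskew := formBaseChange_assemble_add_eq_zero (BettiUniverse.hodge hHD (AbelianVariety.isSmoothProjective_holds (A := A)) 1) hodd ψ hself σ hint b (Pi.single τ N) htr
    have hL := wordDerAt_eq_zero_of_mapsTo_of_skew (BettiUniverse.hodge hHD (AbelianVariety.isSmoothProjective_holds (A := A)) 1) hodd ψ hself σ hreal hint h2 eQ q' hΘ hΘq hYT hYskew u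
    rw [← haEq, hslice_e] at hL
    have hYG : ∀ _t : Fin (2 * p), LinearMap.toMatrix eC eC Y * G = G * LinearMap.toMatrix cbσ cbσ Y :=
      fun _ => by rw [hG, linearMap_toMatrix_mul_basis_toMatrix, basis_toMatrix_mul_linearMap_toMatrix]
    have hblk : LinearMap.toMatrix cbσ cbσ Y = blockLift φ (Pi.single τ N) :=
      toMatrix_assemble_eq_blockLift hint b φ cbσ hcbσ (Pi.single τ N)
    have h3 : wordRepAt ℂ (fun _ : Fin (2 * p) => G)
        (wordDerAt ℂ (fun _ : Fin (2 * p) => blockLift φ (Pi.single τ N)) (wordSlice ax u)) = 0 := by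
      rw [← hblk, wordRepAt_wordDerAt_of_mul_eq ℂ (fun _ : Fin (2 * p) => G) hYG, hL]
    exact wordRepAt_injective ℂ (g := fun _ : Fin (2 * p) => G) (g' := fun _ : Fin (2 * p) => G')
      (funext fun _ => hG'G) (by rw [h3, map_zero])

/-- **`Bᵖ(B) ⊆ Dᵖ(B) ⊗ ℂ` from real characters and Hodge-adapted block bases with rational `θ`-classes**
(assembly: the invariance theorem + the colourwise first fundamental theorem
`wordEval_rmLetters_mem_divisorClassesSpan_of_colourwise`). For `B` with slots over `A`, `σ`, `ψ`, `b` as in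
`exists_invariant_coeff_of_real_characters`, and `ρ(b_τ 0) ⌣ ρ(b_τ 1) ∈ span_ℂ {rational (1,1)-classes of A}`
for every `τ`: every rational `(p,p)`-class on `B` is a `ℂ`-combination of products of `p` rational
`(1,1)`-classes. The tree's `AVSlots.rmHodgeClasses_divisorial` is the field case (there `θ_τ` comes from the
`ψ`-Casimir, `theta_mem_span_rational_oneOne`). [cite: Ribet1983, Thm. 0–1 (pp. 523–525)]
[cite: Hazama1983, Thm. (1.1) and §3 (pp. 305–306)] [cite: MoonenZarhin1999LowDim, §3 Thm. (3.2)(1)] -/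
theorem AVSlots.hodgeClasses_divisorial_of_blockBasis [HodgeTensorFacts.{0, 0}] (hg : AVSlots A B g)
    (hHD : exists_isReal_hodgeModel) (hI : hodgePQ_independent_of_hodgeModel)
    {T : Type} [Fintype T] [DecidableEq T]
    (ψ : (BettiUniverse.hodge hHD (AbelianVariety.isSmoothProjective_holds (A := A)) 1).Polarization)
    (hself : ∀ a : (BettiUniverse.hodge hHD (AbelianVariety.isSmoothProjective_holds (A := A)) 1).endAlg,
      LinearMap.IsAdjointPair ψ.form ψ.form (a : Module.End ℚ (bettiCohomology A.X 1))
        (a : Module.End ℚ (bettiCohomology A.X 1)))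
    (σ : T → ((BettiUniverse.hodge hHD (AbelianVariety.isSmoothProjective_holds (A := A)) 1).endAlg →+* ℂ))
    (hreal : ∀ τ, (starRingEnd ℂ).comp (σ τ) = σ τ)
    (hint : DirectSum.IsInternal fun τ =>
      (BettiUniverse.hodge hHD (AbelianVariety.isSmoothProjective_holds (A := A)) 1).eigenBlock (σ τ))
    (h2 : ∀ τ, Module.finrank ℂ
      ((BettiUniverse.hodge hHD (AbelianVariety.isSmoothProjective_holds (A := A)) 1).eigenBlock (σ τ)) = 2)
    (b : ∀ τ, Module.Basis (Fin 2) ℂ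
      ((BettiUniverse.hodge hHD (AbelianVariety.isSmoothProjective_holds (A := A)) 1).eigenBlock (σ τ)))
    (hb0 : ∀ τ, (b τ 0 : ℂ ⊗[ℚ] bettiCohomology A.X 1) ∈
      (BettiUniverse.hodge hHD (AbelianVariety.isSmoothProjective_holds (A := A)) 1).piece 1 0)
    (hb1 : ∀ τ, (b τ 1 : ℂ ⊗[ℚ] bettiCohomology A.X 1) ∈
      (BettiUniverse.hodge hHD (AbelianVariety.isSmoothProjective_holds (A := A)) 1).piece 0 1)
    (hθ : ∀ τ, cupH1 A (b τ 0 : ℂ ⊗[ℚ] bettiCohomology A.X 1) (b τ 1) ∈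
      Submodule.span ℂ {c : complexBetti A.X 2 | IsRationalClass c ∧ IsOfHodgeType A.dim A.X 2 1 1 c})
    (p : ℕ) (c : complexBetti B.X (2 * p)) (hcQ : IsRationalClass c)
    (hc : IsOfHodgeType B.dim B.X (2 * p) p p c) :
    c ∈ divisorClassesSpan B.X B.dim p := by
  classical
  rcases Nat.eq_zero_or_pos p with rfl | hp
  · exact AbelianVariety.mem_divisorClassesSpan_zero B c
  obtain ⟨a, hca, hkill⟩ :=
    hg.exists_invariant_coeff_of_real_characters hHD hI ψ hself σ hreal hint h2 b hb0 hb1 hp hcQ hc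
  rw [← hca]
  exact wordEval_rmLetters_mem_divisorClassesSpan_of_colourwise g b hθ
    (fun U τ => hkill U τ _ (by simp)) (fun U τ => hkill U τ _ (by simp))

/-- **`IsDivisorGenerated B`** for every abelian variety `B` with slots over an abelian variety `A` carrying the
data of `hodgeClasses_divisorial_of_blockBasis` (the tree's spelling of `B•(B) = D•(B) ⊗ ℂ`).
[cite: Ribet1983, Thm. 0–1] [cite: Hazama1983, Thm. (1.1)] [cite: MoonenZarhin1999LowDim, §3 Thm. (3.2)(1)] -/
theorem AVSlots.isDivisorGenerated_of_blockBasis [HodgeTensorFacts.{0, 0}] (hg : AVSlots A B g)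
    (hHD : exists_isReal_hodgeModel) (hI : hodgePQ_independent_of_hodgeModel)
    {T : Type} [Fintype T] [DecidableEq T]
    (ψ : (BettiUniverse.hodge hHD (AbelianVariety.isSmoothProjective_holds (A := A)) 1).Polarization)
    (hself : ∀ a : (BettiUniverse.hodge hHD (AbelianVariety.isSmoothProjective_holds (A := A)) 1).endAlg,
      LinearMap.IsAdjointPair ψ.form ψ.form (a : Module.End ℚ (bettiCohomology A.X 1))
        (a : Module.End ℚ (bettiCohomology A.X 1)))
    (σ : T → ((BettiUniverse.hodge hHD (AbelianVariety.isSmoothProjective_holds (A := A)) 1).endAlg →+* ℂ))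
    (hreal : ∀ τ, (starRingEnd ℂ).comp (σ τ) = σ τ)
    (hint : DirectSum.IsInternal fun τ =>
      (BettiUniverse.hodge hHD (AbelianVariety.isSmoothProjective_holds (A := A)) 1).eigenBlock (σ τ))
    (h2 : ∀ τ, Module.finrank ℂ
      ((BettiUniverse.hodge hHD (AbelianVariety.isSmoothProjective_holds (A := A)) 1).eigenBlock (σ τ)) = 2)
    (b : ∀ τ, Module.Basis (Fin 2) ℂ
      ((BettiUniverse.hodge hHD (AbelianVariety.isSmoothProjective_holds (A := A)) 1).eigenBlock (σ τ)))
    (hb0 : ∀ τ, (b τ 0 : ℂ ⊗[ℚ] bettiCohomology A.X 1) ∈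
      (BettiUniverse.hodge hHD (AbelianVariety.isSmoothProjective_holds (A := A)) 1).piece 1 0)
    (hb1 : ∀ τ, (b τ 1 : ℂ ⊗[ℚ] bettiCohomology A.X 1) ∈
      (BettiUniverse.hodge hHD (AbelianVariety.isSmoothProjective_holds (A := A)) 1).piece 0 1)
    (hθ : ∀ τ, cupH1 A (b τ 0 : ℂ ⊗[ℚ] bettiCohomology A.X 1) (b τ 1) ∈
      Submodule.span ℂ {c : complexBetti A.X 2 | IsRationalClass c ∧ IsOfHodgeType A.dim A.X 2 1 1 c}) :
    IsDivisorGenerated B :=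
  fun p c hcQ hc => hg.hodgeClasses_divisorial_of_blockBasis hHD hI ψ hself σ hreal hint h2 b hb0 hb1 hθ p c hcQ hc

end RealCharacters

end Literature.AlgebraicGeometry.HodgeTheory

end
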